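import Mathlib
import Literature.MathematicalPhysics.QuantumFieldTheory.Volkov2017.DominatedToyMoments
import Literature.Probability.Distributions.GaussianPiDensity
import HarnessLib

/-!
# Volkov's «case 3» by EXPONENTS — the NECESSITY half (PRD 96, 096018 (2017) §III.A, the sentence after eq. (eq_ab_disp): «if there exists j such that b_j > 2a_j, then we fall into case 3») — PROVED in n coordinates, boundary included, and for any integrand bounded BELOW by the printed toy on a box reaching the face `x_{j₀} = 0`: then `∫_Ω f²/g = ∞` (infinite variance of the weight); likewise `a_{j₀} ≤ 0` under a lower bound `c·Π x_j^{a_j−1} ≤ |I|` gives `I ∉ L¹(Ω)` (infinite mean)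

independent recomputation; certified where stated, statistical where stated; no new-physics claim.

CITATION HEADER (venture `QEDPrecision`, cell `pub-qed`, track TROPICAL seat V3a = `pub-qed-trop-v3-lit-1` gen 10; VALUE-FREE: (non-)
integrability statements about ABSTRACT functions on the unit cube; no Feynman graph, no constant of Volkov's, nothing per Set V family or
word). Third file of the toy's story: `ImportanceSamplingToy.lean` (lit g21/g23) types the printed toy `f = Π a_j x_j^{a_j−1}`,
`g = Π b_j x_j^{b_j−1}` on Ω = (0,1]ⁿ with the EXACT closed form (eq_ab_disp) and the ONE-dimensional divergence `secondMoment_toy_not_integrable`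
(`b ≥ 2a`); `DominatedToyMoments.lean` (V3a gen 9) proves the SUFFICIENCY half in n coordinates for integrands dominated from ABOVE
(`a_j > 0 ⇒` finite mean; `0 < b_j < 2a_j ⇒` finite `∫ f²/g`) and lists as NOT typed «the necessity direction in n dimensions for integrands
bounded BELOW by the toy». This file types exactly that, in the form the track's oracle reading uses (`tropical/view/V3-VOLKOV-DEGREES.md`
§A A.0.7 (i)/(iii), A.21.3 (β)/(ε), A.22.3; REF-PROTOCOL §1): ONE bad exponent on ONE coordinate, witnessed by a lower bound on a box (a
«tube» around the corresponding edge: the other coordinates may be kept away from 0), forces divergence — of the mean when `a_{j₀} ≤ 0`, of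
the second moment under the toy density when `2a_{j₀} − b_{j₀} ≤ 0`.

Source [Volkov2017]: S. Volkov, Phys. Rev. D 96, 096018 (2017) = arXiv:1705.05800 (e-print `amm4_mc_arxiv.tex`, HOME
`data/lit/sources/.cache/1705.05800/`), §III.A "Importance sampling", VERBATIM (tex l.519–533): "1. The function f(x)/g(x) is bounded. In this
case, we will have a stable Monte Carlo convergence with the error that can be approximated by (eq_sigma). … 2. The function f(x)/g(x) is
unbounded, but V(f,g) is finite. In this case, the error can be approximated by (eq_sigma) too. However, the convergence can be unstable. …
3. V(f,g) is infinite. In this case, we will have unstable convergence that is slower than C/√N. An adequate error estimation is difficult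
in this case."; (l.541–559): "Selection of the function g(x) needs a lot of care. For example, let Ω = [0;1]ⁿ, f(x₁,…,x_n) = a₁…a_n
x₁^{a₁−1}…x_n^{a_n−1}, (eq_density_bb) g(x₁,…,x_n) = b₁…b_n x₁^{b₁−1}…x_n^{b_n−1}, a₁,…,a_n,b₁,…,b_n > 0. In this case, (eq_ab_disp)
V(f,g) = a₁²…a_n² / (b₁…b_n (2a₁−b₁)…(2a_n−b_n)) − 1. On the one hand, if there exists j such that b_j > 2a_j, then we fall into case 3. On
the other hand, if we take some small value for all b_j, then the value (eq_ab_disp) can be very big due to the factor 1/(b₁…b_n) when n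
is large."; §III.B (l.602–605): "The numbers Deg({j_l,j_{l+1},…,j_n}), l = 2…n, play the same role in the sector S_{j₁,…,j_n} as
b₁,…,b_n play in (eq_density_bb). Thus, adjusting Deg(s) requires a lot of care."; §III.B footnote (l.806–808): "At the present moment,
there is no mathematical proof that (eq_deg) does not lead to case 3 from Section III.A."

WHAT IS PROVED (namespace `Literature.MathematicalPhysics.QuantumFieldTheory.Volkov2017`; the vocabulary `cube`, `fToyN`, `gToyN`,
`sq_div_toyN_eq`, `cube_eq_restrict`, `integrable_cube_prod_rpow`, `sq_div_gToyN_integrable_of_dominated` of the two companion files is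
REUSED, nothing re-declared):
* `not_integrableOn_prod_rpow_box` — on a box `B = Π_j (u_j, v_j]` with `0 ≤ u_j < v_j` whose `j₀`-th side reaches `0` (`u_{j₀} = 0`),
  `Π_j x_j^{e_j−1}` is NOT integrable as soon as `e_{j₀} ≤ 0` (Tonelli for products: the `j₀`-th factor `∫₀^{v} t^{e−1} dt` is infinite, the
  others are positive) — the divergence half of (eq_ab_disp)'s computation;
* `integrable_cube_prod_rpow_iff` — on Ω, `Π_j x_j^{e_j−1} ∈ L¹ ⇔ ∀ j, e_j > 0`;
* **`sq_div_gToyN_not_integrable`** — THE PRINTED SENTENCE in n coordinates with the boundary: `a_j ≠ 0`, `b_j > 0` and `2a_{j₀} ≤ b_{j₀}`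
  for one `j₀` ⇒ `f²/g ∉ L¹(Ω)` for the toy, i.e. `V(f,g) = ∞`, case 3; **`sq_div_gToyN_integrable_iff`** — for `a_j, b_j > 0`:
  `f²/g ∈ L¹(Ω) ⇔ ∀ j, b_j < 2a_j` (with the companion's sufficiency);
* **`not_integrable_of_prod_rpow_le_on_box`** — MEAN, necessity, dominated from below: if `c·Π_j x_j^{a_j−1} ≤ |I(x)|` on a box `B ⊆ Ω`
  reaching the face `x_{j₀} = 0` (`c > 0`) and `a_{j₀} ≤ 0`, then `I ∉ L¹(Ω)`; `not_integrable_of_prod_rpow_le` — the same with `B = Ω`;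
* **`sq_div_gToyN_not_integrable_of_le_on_box`** — VARIANCE, necessity, dominated from below: if `c·fToyN a ≤ |f|` on such a box,
  `a_j, b_j > 0` and `2a_{j₀} ≤ b_{j₀}`, then `f²/gToyN b ∉ L¹(Ω)` (case 3 for `f` under the toy density); `sq_div_gToyN_not_integrable_of_le`
  — the same with `B = Ω`;
* (§ k-th moment, ⟦lit⟧ corollaries of the printed f and g, as in the companion) `weightN_rpow_mul_gToyN_eq` (pointwise
  `(f/g)^k·g = (Π a_j^k/b_j^{k−1})·Π x_j^{(k a_j − (k−1) b_j) − 1}`); **`momentN_toy_integrable_iff`** — for `a_j, b_j > 0` and real `k`: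
  `E_g (f/g)^k < ∞ ⇔ ∀ j, (k−1)·b_j < k·a_j`; `momentN_toy_integrable_iff_tailIndex` — for `k ≥ 1`: `⇔ k < b_j/(b_j − a_j)` for every `j`
  with `b_j > a_j` (the weight's critical moment order is the minimum of the coordinate tail indices); `secondMomentN_toy_integrable_iff`
  (`k = 2`: `⇔ ∀ j, b_j < 2a_j`), `firstMomentN_toy_integrable` (`k = 1`: always).
THE TRACK'S READING (⟦lit⟧; stated, not asserted beyond the theorems): with `Volkov2017/SectorIntegral.lean` (on one Hepp sector, in Volkov's
variables `t_l`, the normalised sector density is the toy `g` with `b_l = Deg(s^{[l]})` — the §III.B sentence) the sufficiency file said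
«`a_l > 0` edge-wise ⇒ finite mean; `2a_l − Deg_l > 0` edge-wise ⇒ finite second moment» for integrands dominated from ABOVE; this file adds
the converse for integrands dominated from BELOW near one edge: if on a tube `{t_{l₀} ∈ (0, v]} × Π_{l ≠ l₀} [u_l, v_l]` (`u_l > 0`) the
integrand satisfies `|I| ≥ c·t_{l₀}^{a−1}` (take `a_l := 1` off the edge — the other factors are then constants), then `a ≤ 0` ⇒ infinite
MEAN and `2a − Deg_{l₀} ≤ 0` ⇒ infinite VARIANCE under that density: Volkov's «case 3», which his Deg does not exclude (the footnote above),
is decided edge by edge by the same two inequalities whenever the leading behaviour along the edge is ATTAINED (no cancellation below the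
term-wise order). NOT typed: that a given subtracted Feynman integrand admits such a lower bound (the track measures / certifies leading
orders per face; `Volkov2016/RayConvergenceCriterion.lean` A.21.3 (β) explains why a non-positive exponent of the term-wise MAJORANT alone
proves nothing about the true integral); the simplex-to-sector change of variables; anything about Volkov's actual `Deg`. 0 named facts.
-/

noncomputable section

open MeasureTheory Set Filter
open scoped ENNReal

namespace Literature.MathematicalPhysics.QuantumFieldTheory.Volkov2017

variable {n : ℕ}

/-! ## One coordinate: `∫₀^v t^{e−1} dt = ∞` for `e ≤ 0`, and `∫_u^v t^{r} dt > 0` -/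

/-- For `e ≤ 0` and `v > 0`, `t ↦ t^{e−1}` is not integrable on `(0, v]`. [folklore] -/
private theorem not_integrableOn_rpow_Ioc {e v : ℝ} (he : e ≤ 0) (hv : 0 < v) :
    ¬ IntegrableOn (fun t : ℝ => t ^ (e - 1)) (Ioc 0 v) := by
  intro h
  have h' : IntegrableOn (fun t : ℝ => t ^ (e - 1)) (Ioo 0 v) := h.mono_set Ioo_subset_Ioc_self
  rw [intervalIntegral.integrableOn_Ioo_rpow_iff hv] at h'
  linarith

/-- Hence `∫⁻_{(0,v]} t^{e−1} = ∞` for `e ≤ 0`, `v > 0`. [folklore] -/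
private theorem lintegral_rpow_Ioc_eq_top {e v : ℝ} (he : e ≤ 0) (hv : 0 < v) :
    ∫⁻ t in Ioc (0 : ℝ) v, ENNReal.ofReal (t ^ (e - 1)) = ∞ := by
  by_contra hne
  apply not_integrableOn_rpow_Ioc he hv
  have hmeas : AEStronglyMeasurable (fun t : ℝ => t ^ (e - 1)) ((volume : Measure ℝ).restrict (Ioc 0 v)) :=
    (measurable_id'.pow_const (e - 1)).aestronglyMeasurable
  refine ⟨hmeas, ?_⟩
  rw [hasFiniteIntegral_iff_ofReal]
  · exact lt_top_iff_ne_top.mpr hne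
  · filter_upwards [ae_restrict_mem measurableSet_Ioc] with t ht
    exact Real.rpow_nonneg ht.1.le _

/-- `∫⁻_{(u,v]} t^{r} > 0` for `0 ≤ u < v` and any real `r`. [folklore] -/
private theorem lintegral_rpow_Ioc_pos (r : ℝ) {u v : ℝ} (hu : 0 ≤ u) (huv : u < v) :
    0 < ∫⁻ t in Ioc u v, ENNReal.ofReal (t ^ r) := by
  rw [setLIntegral_pos_iff (measurable_id'.pow_const r).ennreal_ofReal]
  have hsub : Ioc u v ⊆ Function.support (fun t : ℝ => ENNReal.ofReal (t ^ r)) ∩ Ioc u v := by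
    intro t ht
    refine ⟨?_, ht⟩
    rw [Function.mem_support]
    exact (ENNReal.ofReal_pos.mpr (Real.rpow_pos_of_pos (hu.trans_lt ht.1) _)).ne'
  calc (0 : ℝ≥0∞) < volume (Ioc u v) := by
        rw [Real.volume_Ioc]; exact ENNReal.ofReal_pos.mpr (by linarith)
    _ ≤ volume (Function.support (fun t : ℝ => ENNReal.ofReal (t ^ r)) ∩ Ioc u v) := measure_mono hsub

/-! ## The box lemma: one non-positive exponent on a side reaching `0` makes `Π_j x_j^{e_j−1}` non-integrable -/

/-- A box `Π_j (u_j, v_j]` is measurable. [folklore] -/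
private theorem measurableSet_box (u v : Fin n → ℝ) : MeasurableSet (Set.pi univ fun j => Ioc (u j) (v j)) :=
  MeasurableSet.univ_pi fun _ => measurableSet_Ioc

/-- `Π_j x_j^{e_j}` is measurable. [folklore] -/
private theorem measurable_prod_rpow (e : Fin n → ℝ) : Measurable fun x : Fin n → ℝ => ∏ j, x j ^ e j :=
  Finset.measurable_prod _ fun j _ => (measurable_pi_apply j).pow_const _

/-- **The divergence half of (eq_ab_disp)'s computation.** On a box `B = Π_j (u_j, v_j]`, `0 ≤ u_j < v_j`, whose `j₀`-th side reaches the
face `x_{j₀} = 0` (`u_{j₀} = 0`), the product `Π_j x_j^{e_j−1}` is NOT Lebesgue-integrable as soon as `e_{j₀} ≤ 0`: by Tonelli the integral of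
this non-negative product is `Π_j ∫_{u_j}^{v_j} t^{e_j−1} dt`, whose `j₀`-th factor is `+∞` and whose other factors are positive.
[cite: Volkov2017, §III.A (eq_ab_disp and the sentence «if there exists j such that b_j > 2a_j, then we fall into case 3», l.549–555)] -/
theorem not_integrableOn_prod_rpow_box (e u v : Fin n → ℝ) (hu : ∀ j, 0 ≤ u j) (huv : ∀ j, u j < v j)
    (j₀ : Fin n) (he : e j₀ ≤ 0) (hu₀ : u j₀ = 0) :
    ¬ IntegrableOn (fun x : Fin n → ℝ => ∏ j, x j ^ (e j - 1)) (Set.pi univ fun j => Ioc (u j) (v j)) := by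
  intro hint
  have hμ : (volume : Measure (Fin n → ℝ)).restrict (Set.pi univ fun j => Ioc (u j) (v j)) =
      Measure.pi fun j => (volume : Measure ℝ).restrict (Ioc (u j) (v j)) := by
    rw [volume_pi, Measure.restrict_pi_pi]
  have hmem : ∀ᵐ x ∂((volume : Measure (Fin n → ℝ)).restrict (Set.pi univ fun j => Ioc (u j) (v j))),
      ∀ j, x j ∈ Ioc (u j) (v j) := by
    filter_upwards [ae_restrict_mem (measurableSet_box u v)] with x hx
    exact fun j => hx j (mem_univ j)
  have hnonneg : 0 ≤ᵐ[(volume : Measure (Fin n → ℝ)).restrict (Set.pi univ fun j => Ioc (u j) (v j))]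
      fun x : Fin n → ℝ => ∏ j, x j ^ (e j - 1) :=
    hmem.mono fun x hx => Finset.prod_nonneg fun j _ => Real.rpow_nonneg ((hu j).trans (hx j).1.le) _
  have hfi := (hasFiniteIntegral_iff_ofReal hnonneg).mp hint.hasFiniteIntegral
  have hcongr : ∫⁻ x, ENNReal.ofReal (∏ j, x j ^ (e j - 1))
        ∂((volume : Measure (Fin n → ℝ)).restrict (Set.pi univ fun j => Ioc (u j) (v j)))
      = ∫⁻ x, ∏ j, ENNReal.ofReal (x j ^ (e j - 1))
        ∂((volume : Measure (Fin n → ℝ)).restrict (Set.pi univ fun j => Ioc (u j) (v j))) := by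
    refine lintegral_congr_ae (hmem.mono fun x hx => ?_)
    exact ENNReal.ofReal_prod_of_nonneg fun j _ => Real.rpow_nonneg ((hu j).trans (hx j).1.le) _
  rw [hcongr, hμ, Literature.Probability.Distributions.lintegral_fin_nat_prod_eq_prod _
      (fun j t => ENNReal.ofReal (t ^ (e j - 1))) (fun j => (measurable_id'.pow_const _).ennreal_ofReal)] at hfi
  have htop : ∏ j, ∫⁻ t, ENNReal.ofReal (t ^ (e j - 1)) ∂((volume : Measure ℝ).restrict (Ioc (u j) (v j))) = ∞ := by
    rw [← Finset.mul_prod_erase Finset.univ _ (Finset.mem_univ j₀)]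
    have h0 : ∫⁻ t, ENNReal.ofReal (t ^ (e j₀ - 1)) ∂((volume : Measure ℝ).restrict (Ioc (u j₀) (v j₀))) = ∞ := by
      rw [hu₀]
      exact lintegral_rpow_Ioc_eq_top he (hu₀.symm.trans_lt (huv j₀))
    rw [h0]
    refine ENNReal.top_mul (Finset.prod_ne_zero_iff.mpr fun j _ => ?_)
    exact (lintegral_rpow_Ioc_pos (e j - 1) (hu j) (huv j)).ne'
  rw [htop] at hfi
  exact lt_irrefl _ hfi

/-- On Ω = (0,1]ⁿ: `Π_j x_j^{e_j−1} ∈ L¹(Ω) ⇔ ∀ j, e_j > 0` (the companion's `integrable_cube_prod_rpow` and the box lemma with `B = Ω`).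
[cite: Volkov2017, §III.A (eq_ab_disp, l.549–555)] -/
theorem integrable_cube_prod_rpow_iff (e : Fin n → ℝ) :
    Integrable (fun x : Fin n → ℝ => ∏ j, x j ^ (e j - 1)) (cube n) ↔ ∀ j, 0 < e j := by
  refine ⟨fun h j => ?_, integrable_cube_prod_rpow e⟩
  by_contra hj
  rw [not_lt] at hj
  have h' : IntegrableOn (fun x : Fin n → ℝ => ∏ j, x j ^ (e j - 1)) (Set.pi univ fun _ => Ioc (0 : ℝ) 1) := by
    rw [IntegrableOn, ← cube_eq_restrict]; exact h
  exact not_integrableOn_prod_rpow_box e (fun _ => 0) (fun _ => 1) (fun _ => le_rfl) (fun _ => one_pos) j hj rfl h'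

/-! ## The printed sentence in n coordinates -/

/-- `cube n`-almost every point lies in (0,1]ⁿ. [folklore] -/
private theorem ae_mem_cube : ∀ᵐ x ∂(cube n), ∀ j, x j ∈ Set.Ioc (0 : ℝ) 1 := by
  rw [cube_eq_restrict]
  filter_upwards [ae_restrict_mem (MeasurableSet.univ_pi fun _ => measurableSet_Ioc)] with x hx
  exact fun j => hx j (Set.mem_univ j)

/-- The toy integrand is measurable. [folklore] -/
private theorem measurable_fToyN (a : Fin n → ℝ) : Measurable (fToyN a) := by
  unfold fToyN fToy
  exact Finset.measurable_prod _ fun j _ => ((measurable_pi_apply j).pow_const _).const_mul _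

/-- The toy density is measurable. [folklore] -/
private theorem measurable_gToyN' (b : Fin n → ℝ) : Measurable (gToyN b) := by
  unfold gToyN gToy
  exact Finset.measurable_prod _ fun j _ => ((measurable_pi_apply j).pow_const _).const_mul _

/-- The toy density is positive on the open orthant. [folklore] -/
private theorem gToyN_pos' (b x : Fin n → ℝ) (hb : ∀ j, 0 < b j) (hx : ∀ j, 0 < x j) : 0 < gToyN b x := by
  unfold gToyN gToy
  exact Finset.prod_pos fun j _ => mul_pos (hb j) (Real.rpow_pos_of_pos (hx j) _)

/-- The toy integrand is non-negative on the open orthant (for `a_j > 0`). [folklore] -/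
private theorem fToyN_nonneg' (a x : Fin n → ℝ) (ha : ∀ j, 0 < a j) (hx : ∀ j, 0 < x j) : 0 ≤ fToyN a x := by
  unfold fToyN fToy
  exact Finset.prod_nonneg fun j _ => mul_nonneg (ha j).le (Real.rpow_nonneg (hx j).le _)

/-- `f²/g` of the toy is a.e.-strongly measurable on Ω. [folklore] -/
private theorem aestronglyMeasurable_sq_div_toyN (a b : Fin n → ℝ) :
    AEStronglyMeasurable (fun x => fToyN a x ^ 2 / gToyN b x) (cube n) :=
  (((measurable_fToyN a).pow_const 2).div (measurable_gToyN' b)).aestronglyMeasurable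

/-- **«if there exists j such that b_j > 2a_j, then we fall into case 3»** — in n coordinates, boundary included: for the printed toy
`f = Π a_j x_j^{a_j−1}`, `g = Π b_j x_j^{b_j−1}` (`a_j ≠ 0`, `b_j > 0`), ONE index `j₀` with `2a_{j₀} ≤ b_{j₀}` makes `f²/g` non-integrable on
Ω = (0,1]ⁿ, i.e. `V(f,g) = ∫_Ω f²/g − (∫_Ω f)² = ∞` (whatever the other exponents; the companion's `secondMoment_toy_not_integrable` is `n = 1`).
[cite: Volkov2017, §III.A (eq_ab_disp) and l.554–555; case 3 l.530–533] -/
theorem sq_div_gToyN_not_integrable (a b : Fin n → ℝ) (ha : ∀ j, a j ≠ 0) (hb : ∀ j, 0 < b j)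
    (j₀ : Fin n) (h : 2 * a j₀ ≤ b j₀) :
    ¬ Integrable (fun x => fToyN a x ^ 2 / gToyN b x) (cube n) := by
  intro hint
  have hK : (∏ j, a j ^ 2 / b j) ≠ 0 :=
    Finset.prod_ne_zero_iff.mpr fun j _ => div_ne_zero (pow_ne_zero 2 (ha j)) (hb j).ne'
  have hint' : Integrable (fun x : Fin n → ℝ => ∏ j, x j ^ (2 * a j - b j - 1)) (cube n) := by
    refine (hint.const_mul (∏ j, a j ^ 2 / b j)⁻¹).congr ?_
    filter_upwards [ae_mem_cube] with x hx
    rw [sq_div_toyN_eq a b x (fun j => (hx j).1) (fun j => (hb j).ne'), ← mul_assoc, inv_mul_cancel₀ hK, one_mul]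
  have hj := (integrable_cube_prod_rpow_iff (fun j => 2 * a j - b j)).mp hint' j₀
  linarith

/-- For `a_j, b_j > 0`: `f²/g ∈ L¹(Ω) ⇔ ∀ j, b_j < 2a_j` — (eq_ab_disp) is finite exactly in the printed range, case 3 exactly outside it.
[cite: Volkov2017, §III.A (eq_ab_disp) and l.554–555] -/
theorem sq_div_gToyN_integrable_iff (a b : Fin n → ℝ) (ha : ∀ j, 0 < a j) (hb : ∀ j, 0 < b j) :
    Integrable (fun x => fToyN a x ^ 2 / gToyN b x) (cube n) ↔ ∀ j, b j < 2 * a j := by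
  refine ⟨fun h j => ?_, fun h => ?_⟩
  · by_contra hj
    rw [not_lt] at hj
    exact sq_div_gToyN_not_integrable a b (fun j => (ha j).ne') hb j hj h
  · refine sq_div_gToyN_integrable_of_dominated (f := fToyN a) (C := 1)
      (measurable_fToyN a).aestronglyMeasurable hb h fun x hx => ?_
    rw [one_mul, abs_of_nonneg (fToyN_nonneg' a x ha fun j => (hx j).1)]

/-! ## Dominated from BELOW: the necessity directions for general integrands -/

/-- **Infinite MEAN by one exponent (box / tube form).** Let `B = Π_j (u_j, v_j] ⊆ Ω` (`0 ≤ u_j < v_j ≤ 1`) reach the face `x_{j₀} = 0`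
(`u_{j₀} = 0`), and let `c·Π_j x_j^{a_j−1} ≤ |I(x)|` on `B` with `c > 0`. If `a_{j₀} ≤ 0` then `I ∉ L¹(Ω)`. (Off the edge one may take
`a_j = 1`, `u_j > 0`: the hypothesis is then a lower bound `c·x_{j₀}^{a_{j₀}−1} ≤ |I|` on a tube around the `j₀`-th edge only.)
[cite: Volkov2017, §III.A (the toy f with a_j > 0, ∫_Ω f = 1, l.541–549; eq_ab_disp)] -/
theorem not_integrable_of_prod_rpow_le_on_box {I : (Fin n → ℝ) → ℝ} {c : ℝ} (hc : 0 < c) {a : Fin n → ℝ}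
    (u v : Fin n → ℝ) (hu : ∀ j, 0 ≤ u j) (huv : ∀ j, u j < v j) (hv : ∀ j, v j ≤ 1)
    (j₀ : Fin n) (h : a j₀ ≤ 0) (hu₀ : u j₀ = 0)
    (hge : ∀ x : Fin n → ℝ, (∀ j, x j ∈ Ioc (u j) (v j)) → c * ∏ j, x j ^ (a j - 1) ≤ |I x|) :
    ¬ Integrable I (cube n) := by
  intro hint
  have hB : (Set.pi univ fun j => Ioc (u j) (v j)) ⊆ Set.pi univ fun _ => Ioc (0 : ℝ) 1 :=
    Set.pi_mono fun j _ => Ioc_subset_Ioc (hu j) (hv j)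
  have hI1 : IntegrableOn I (Set.pi univ fun _ => Ioc (0 : ℝ) 1) := by
    rw [IntegrableOn, ← cube_eq_restrict]; exact hint
  have hIB : IntegrableOn I (Set.pi univ fun j => Ioc (u j) (v j)) := hI1.mono_set hB
  have hP : IntegrableOn (fun x : Fin n → ℝ => ∏ j, x j ^ (a j - 1)) (Set.pi univ fun j => Ioc (u j) (v j)) := by
    refine Integrable.mono' ((hIB.abs).const_mul c⁻¹)
      (measurable_prod_rpow fun j => a j - 1).aestronglyMeasurable ?_
    filter_upwards [ae_restrict_mem (measurableSet_box u v)] with x hx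
    have hx' : ∀ j, x j ∈ Ioc (u j) (v j) := fun j => hx j (mem_univ j)
    rw [Real.norm_eq_abs, abs_of_nonneg
      (Finset.prod_nonneg fun j _ => Real.rpow_nonneg ((hu j).trans (hx' j).1.le) _),
      ← inv_mul_cancel_left₀ hc.ne' (∏ j, x j ^ (a j - 1))]
    exact mul_le_mul_of_nonneg_left (hge x hx') (inv_nonneg.mpr hc.le)
  exact not_integrableOn_prod_rpow_box a u v hu huv j₀ h hu₀ hP

/-- **Infinite MEAN by one exponent (whole cube).** If `c·Π_j x_j^{a_j−1} ≤ |I(x)|` on Ω = (0,1]ⁿ with `c > 0` and `a_{j₀} ≤ 0` for one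
`j₀`, then `I ∉ L¹(Ω)` — the converse of the companion's `integrable_of_dominated_fToyN` (`a_j > 0 ⇒` finite mean for integrands dominated
from above). [cite: Volkov2017, §III.A (l.541–549; eq_ab_disp)] -/
theorem not_integrable_of_prod_rpow_le {I : (Fin n → ℝ) → ℝ} {c : ℝ} (hc : 0 < c) {a : Fin n → ℝ}
    (j₀ : Fin n) (h : a j₀ ≤ 0)
    (hge : ∀ x : Fin n → ℝ, (∀ j, x j ∈ Ioc (0 : ℝ) 1) → c * ∏ j, x j ^ (a j - 1) ≤ |I x|) :
    ¬ Integrable I (cube n) :=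
  not_integrable_of_prod_rpow_le_on_box hc (fun _ => 0) (fun _ => 1) (fun _ => le_rfl) (fun _ => one_pos)
    (fun _ => le_rfl) j₀ h rfl hge

/-- **Case 3 by one exponent (box / tube form).** Let `B = Π_j (u_j, v_j] ⊆ Ω` (`0 ≤ u_j < v_j ≤ 1`) reach the face `x_{j₀} = 0`
(`u_{j₀} = 0`), let `c·f_toy ≤ |f|` on `B` with `f_toy = Π a_j x_j^{a_j−1}`, `a_j > 0`, `c > 0`, and let the density be the toy
`g = Π b_j x_j^{b_j−1}`, `b_j > 0`. If `2a_{j₀} ≤ b_{j₀}` then `f²/g ∉ L¹(Ω)`: the weight `f/g` has INFINITE second moment under `g` —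
Volkov's case 3 — whatever happens off `B` and whatever the other exponents.
[cite: Volkov2017, §III.A (eq_ab_disp) and l.554–555; case 3 l.530–533; §III.B l.602–605 («Deg … play the same role … as b₁,…,b_n»)] -/
theorem sq_div_gToyN_not_integrable_of_le_on_box {f : (Fin n → ℝ) → ℝ} {c : ℝ} (hc : 0 < c) {a b : Fin n → ℝ}
    (ha : ∀ j, 0 < a j) (hb : ∀ j, 0 < b j)
    (u v : Fin n → ℝ) (hu : ∀ j, 0 ≤ u j) (huv : ∀ j, u j < v j) (hv : ∀ j, v j ≤ 1)
    (j₀ : Fin n) (h : 2 * a j₀ ≤ b j₀) (hu₀ : u j₀ = 0)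
    (hge : ∀ x : Fin n → ℝ, (∀ j, x j ∈ Ioc (u j) (v j)) → c * fToyN a x ≤ |f x|) :
    ¬ Integrable (fun x => f x ^ 2 / gToyN b x) (cube n) := by
  intro hint
  have hB : (Set.pi univ fun j => Ioc (u j) (v j)) ⊆ Set.pi univ fun _ => Ioc (0 : ℝ) 1 :=
    Set.pi_mono fun j _ => Ioc_subset_Ioc (hu j) (hv j)
  have hI1 : IntegrableOn (fun x => f x ^ 2 / gToyN b x) (Set.pi univ fun _ => Ioc (0 : ℝ) 1) := by
    rw [IntegrableOn, ← cube_eq_restrict]; exact hint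
  have hIB : IntegrableOn (fun x => f x ^ 2 / gToyN b x) (Set.pi univ fun j => Ioc (u j) (v j)) :=
    hI1.mono_set hB
  have hK : 0 < ∏ j, a j ^ 2 / b j := Finset.prod_pos fun j _ => div_pos (pow_pos (ha j) 2) (hb j)
  -- on B: Π x_j^{(2a_j − b_j) − 1} = K⁻¹ f_toy²/g ≤ (K c²)⁻¹ f²/g
  have hP : IntegrableOn (fun x : Fin n → ℝ => ∏ j, x j ^ (2 * a j - b j - 1))
      (Set.pi univ fun j => Ioc (u j) (v j)) := by
    refine Integrable.mono' (hIB.const_mul ((∏ j, a j ^ 2 / b j) * c ^ 2)⁻¹)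
      (measurable_prod_rpow fun j => 2 * a j - b j - 1).aestronglyMeasurable ?_
    filter_upwards [ae_restrict_mem (measurableSet_box u v)] with x hx
    have hx' : ∀ j, x j ∈ Ioc (u j) (v j) := fun j => hx j (mem_univ j)
    have hx0 : ∀ j, 0 < x j := fun j => (hu j).trans_lt (hx' j).1
    have hg : 0 < gToyN b x := gToyN_pos' b x hb hx0
    have hsq : (c * fToyN a x) ^ 2 ≤ f x ^ 2 := by
      rw [← sq_abs (f x)]
      exact pow_le_pow_left₀ (mul_nonneg hc.le (fToyN_nonneg' a x ha hx0)) (hge x hx') 2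
    rw [Real.norm_eq_abs, abs_of_nonneg (Finset.prod_nonneg fun j _ => Real.rpow_nonneg (hx0 j).le _)]
    have hprod : ∏ j, x j ^ (2 * a j - b j - 1) = (∏ j, a j ^ 2 / b j)⁻¹ * (fToyN a x ^ 2 / gToyN b x) := by
      rw [sq_div_toyN_eq a b x hx0 fun j => (hb j).ne', ← mul_assoc, inv_mul_cancel₀ hK.ne', one_mul]
    rw [hprod]
    calc (∏ j, a j ^ 2 / b j)⁻¹ * (fToyN a x ^ 2 / gToyN b x)
        = ((∏ j, a j ^ 2 / b j) * c ^ 2)⁻¹ * ((c * fToyN a x) ^ 2 / gToyN b x) := by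
          field_simp
      _ ≤ ((∏ j, a j ^ 2 / b j) * c ^ 2)⁻¹ * (f x ^ 2 / gToyN b x) :=
          mul_le_mul_of_nonneg_left (div_le_div_of_nonneg_right hsq hg.le) (by positivity)
  exact not_integrableOn_prod_rpow_box (fun j => 2 * a j - b j) u v hu huv j₀ (by linarith) hu₀ hP

/-- **Case 3 by one exponent (whole cube).** If `c·Π a_j x_j^{a_j−1} ≤ |f|` on Ω (`a_j > 0`, `c > 0`) and the density is
`g = Π b_j x_j^{b_j−1}` (`b_j > 0`) with `2a_{j₀} ≤ b_{j₀}` for one `j₀`, then `f²/g ∉ L¹(Ω)` — the converse of the companion's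
`sq_div_gToyN_integrable_of_dominated` (`0 < b_j < 2a_j ⇒` finite second moment for integrands dominated from above).
[cite: Volkov2017, §III.A (eq_ab_disp) and l.554–555; §III.B l.602–605] -/
theorem sq_div_gToyN_not_integrable_of_le {f : (Fin n → ℝ) → ℝ} {c : ℝ} (hc : 0 < c) {a b : Fin n → ℝ}
    (ha : ∀ j, 0 < a j) (hb : ∀ j, 0 < b j) (j₀ : Fin n) (h : 2 * a j₀ ≤ b j₀)
    (hge : ∀ x : Fin n → ℝ, (∀ j, x j ∈ Ioc (0 : ℝ) 1) → c * fToyN a x ≤ |f x|) :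
    ¬ Integrable (fun x => f x ^ 2 / gToyN b x) (cube n) :=
  sq_div_gToyN_not_integrable_of_le_on_box hc ha hb (fun _ => 0) (fun _ => 1) (fun _ => le_rfl)
    (fun _ => one_pos) (fun _ => le_rfl) j₀ h rfl hge

/-! ## The k-th moment of the weight in n coordinates: finite iff `k·a_j − (k−1)·b_j > 0` for every `j` (the tail-index reading)

The companion `ImportanceSamplingToy.lean` proves, in ONE coordinate, `E_g (f/g)^k = a^k/(b^{k−1}(ka − (k−1)b))` for `(k−1)b < ka`
(`moment_toy`) and non-integrability otherwise (`moment_toy_not_integrable`), i.e. under `g` the weight is Pareto with index `α = b/(b−a)`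
(`b > a`) and its k-th moment is finite iff `k < α`. With the box lemma the same dichotomy holds in n coordinates, coordinate by coordinate:
`∫_Ω (f/g)^k g < ∞ ⇔ ∀ j, k·a_j − (k−1)·b_j > 0`; `k = 1` is the (always finite) mean, `k = 2` is (eq_ab_disp)'s range `b_j < 2a_j`. These
are ELEMENTARY CONSEQUENCES of the printed f and g (⟦lit⟧ corollaries, as in the companion): the source prints the three cases and the `k = 2`
criterion only. -/

/-- One factor of the printed f is non-negative on the positive axis (`a > 0`). [folklore] -/
private theorem fToy_nonneg' {a x : ℝ} (ha : 0 < a) (hx : 0 < x) : 0 ≤ fToy a x := by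
  unfold fToy; exact mul_nonneg ha.le (Real.rpow_nonneg hx.le _)

/-- One factor of the printed g is non-negative on the positive axis (`b > 0`). [folklore] -/
private theorem gToy_nonneg' {b x : ℝ} (hb : 0 < b) (hx : 0 < x) : 0 ≤ gToy b x := by
  unfold gToy; exact mul_nonneg hb.le (Real.rpow_nonneg hx.le _)

/-- Pointwise on the open orthant: `(f/g)^k · g = (Π_j a_j^k/b_j^{k−1}) · Π_j x_j^{(k a_j − (k−1) b_j) − 1}` (real `k`; `a_j, b_j > 0`) — the
companion's `weight_rpow_mul_gToy_eq` coordinate by coordinate. Elementary consequence of the printed f and g.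
[cite: Volkov2017, §III.A (eq_density_bb, l.541–548)] -/
theorem weightN_rpow_mul_gToyN_eq (a b : Fin n → ℝ) (ha : ∀ j, 0 < a j) (hb : ∀ j, 0 < b j) (k : ℝ)
    (x : Fin n → ℝ) (hx : ∀ j, 0 < x j) :
    (fToyN a x / gToyN b x) ^ k * gToyN b x
      = (∏ j, a j ^ k / b j ^ (k - 1)) * ∏ j, x j ^ ((k * a j - (k - 1) * b j) - 1) := by
  unfold fToyN gToyN
  rw [← Finset.prod_div_distrib, ← Real.finsetProd_rpow _ _
      (fun j _ => div_nonneg (fToy_nonneg' (ha j) (hx j)) (gToy_nonneg' (hb j) (hx j))),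
    ← Finset.prod_mul_distrib, ← Finset.prod_mul_distrib]
  refine Finset.prod_congr rfl fun j _ => ?_
  rw [weight_rpow_mul_gToy_eq (ha j) (hb j) k (hx j)]
  congr 1
  ring_nf

/-- **The k-th moment of the weight, n coordinates**: for the printed toy (`a_j, b_j > 0`) and real `k`, the k-th-moment integrand
`(f/g)^k · g` is integrable on Ω = (0,1]ⁿ — i.e. `E_g (f/g)^k < ∞` — iff `(k−1)·b_j < k·a_j` for EVERY `j` (one bad coordinate suffices for
divergence: the box lemma). `k = 2`: (eq_ab_disp)'s range / case 3. Elementary consequence of the printed f and g.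
[cite: Volkov2017, §III.A (eq_ab_disp) and l.554–555; cases 1–3 l.519–533] -/
theorem momentN_toy_integrable_iff (a b : Fin n → ℝ) (ha : ∀ j, 0 < a j) (hb : ∀ j, 0 < b j) (k : ℝ) :
    Integrable (fun x => (fToyN a x / gToyN b x) ^ k * gToyN b x) (cube n) ↔ ∀ j, (k - 1) * b j < k * a j := by
  have hK : (∏ j, a j ^ k / b j ^ (k - 1)) ≠ 0 :=
    Finset.prod_ne_zero_iff.mpr fun j _ =>
      div_ne_zero (Real.rpow_pos_of_pos (ha j) _).ne' (Real.rpow_pos_of_pos (hb j) _).ne'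
  have hiff : Integrable (fun x => (fToyN a x / gToyN b x) ^ k * gToyN b x) (cube n) ↔
      Integrable (fun x : Fin n → ℝ => ∏ j, x j ^ ((k * a j - (k - 1) * b j) - 1)) (cube n) := by
    constructor
    · intro h
      refine (h.const_mul (∏ j, a j ^ k / b j ^ (k - 1))⁻¹).congr ?_
      filter_upwards [ae_mem_cube] with x hx
      rw [weightN_rpow_mul_gToyN_eq a b ha hb k x fun j => (hx j).1, ← mul_assoc, inv_mul_cancel₀ hK, one_mul]
    · intro h
      refine (h.const_mul (∏ j, a j ^ k / b j ^ (k - 1))).congr ?_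
      filter_upwards [ae_mem_cube] with x hx
      rw [weightN_rpow_mul_gToyN_eq a b ha hb k x fun j => (hx j).1]
  rw [hiff, integrable_cube_prod_rpow_iff]
  exact forall_congr' fun j => by constructor <;> intro h <;> linarith

/-- **Tail-index form** (`k ≥ 1`): the k-th moment of the weight is finite iff `k < α_j := b_j/(b_j − a_j)` for every coordinate with
`b_j > a_j` (coordinates with `b_j ≤ a_j` — bounded factor, case 1 — impose nothing); so the weight's critical moment order in n
coordinates is `min_j α_j` over the coordinates with `b_j > a_j` (the companion's `lt_tailIndex_iff` is one coordinate). Elementary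
consequence of the printed f and g. [cite: Volkov2017, §III.A (eq_ab_disp) and l.554–555; cases 1–3 l.519–533] -/
theorem momentN_toy_integrable_iff_tailIndex (a b : Fin n → ℝ) (ha : ∀ j, 0 < a j) (hb : ∀ j, 0 < b j)
    {k : ℝ} (hk : 1 ≤ k) :
    Integrable (fun x => (fToyN a x / gToyN b x) ^ k * gToyN b x) (cube n) ↔
      ∀ j, a j < b j → k < b j / (b j - a j) := by
  rw [momentN_toy_integrable_iff a b ha hb k]
  refine forall_congr' fun j => ⟨fun h hab => (lt_tailIndex_iff hab k).mpr h, fun h => ?_⟩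
  rcases lt_or_ge (a j) (b j) with hab | hba
  · exact (lt_tailIndex_iff hab k).mp (h hab)
  · nlinarith [ha j, hba, hk]

/-- In particular (`k = 2`): `E_g (f/g)² < ∞ ⇔ ∀ j, b_j < 2a_j` — (eq_ab_disp)'s range once more, now for the integrand `(f/g)²·g`
(= `f²/g` on the open orthant). [cite: Volkov2017, §III.A (eq_ab_disp) and l.554–555] -/
theorem secondMomentN_toy_integrable_iff (a b : Fin n → ℝ) (ha : ∀ j, 0 < a j) (hb : ∀ j, 0 < b j) :
    Integrable (fun x => (fToyN a x / gToyN b x) ^ (2 : ℝ) * gToyN b x) (cube n) ↔ ∀ j, b j < 2 * a j := by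
  rw [momentN_toy_integrable_iff a b ha hb 2]
  exact forall_congr' fun j => by constructor <;> intro h <;> linarith

/-- … and (`k = 1`) the mean of the weight is always finite (`∫_Ω (f/g)·g = ∫_Ω f = 1`). [cite: Volkov2017, §III.A (l.541–549)] -/
theorem firstMomentN_toy_integrable (a b : Fin n → ℝ) (ha : ∀ j, 0 < a j) (hb : ∀ j, 0 < b j) :
    Integrable (fun x => (fToyN a x / gToyN b x) ^ (1 : ℝ) * gToyN b x) (cube n) := by
  rw [momentN_toy_integrable_iff a b ha hb 1]
  intro j
  have := ha j
  linarith

end Literature.MathematicalPhysics.QuantumFieldTheory.Volkov2017
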